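import Literature.AlgebraicGeometry.Deformation.SmoothSchemeLiftObstructionLocalize
import HarnessLib

/-!
# Restriction of a chartwise lift `F : A' ⊗_k B → A' ⊗_k C` of a ring map to localized charts
# (Hartshorne, *Deformation Theory*, proof of Thm. 10.2: «restricting to `U_{ijk}`» — for a lifted MORPHISM of deformations)

Layer `Literature/AlgebraicGeometry/Deformation`, namespace `Literature.AlgebraicGeometry.Deformation.SmoothAffineDeformation`
(THEOREMS only: no definition, no instance, no notation, no named fact).  Companion of ★ `SmoothSchemeLiftObstructionLocalize` §1
(restriction of an AUTOMORPHISM `ψ'` of `A' ⊗_k B` to `A' ⊗_k B_S`).  Here the datum is an `A'`-algebra MAP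
`F : A' ⊗_k B → A' ⊗_k C` between the trivial deformations of two affine charts which reduces to `1 ⊗ g` modulo a NILPOTENT ideal
`𝔫' ⊆ A'` for a `k`-algebra map `g : B → C` (a chartwise lift of a morphism `f₀ : Y₀ → X₀` of deformations, `g = f♯`), and two
localizations `B → B_S`, `C → C_T` such that `g(S)` becomes invertible in `C_T` (for `f` and principal opens: `T ∋ f♯(s)`):

* `isUnit_map_apply_of_sub_mem₂` — `(1 ⊗ loc_C)(F(1 ⊗ s))` is a unit (`= 1 ⊗ g(s)` + nilpotent);
* **`exists_algHom_localization₂`** — there is an `A'`-algebra map `F_S : A' ⊗_k B_S → A' ⊗_k C_T` with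
  `F_S ∘ (1 ⊗ loc_B) = (1 ⊗ loc_C) ∘ F` (Mathlib `IsLocalization.liftAlgHom`, `Algebra.TensorProduct.lift`); it is unique
  (`algHom_localization₂_unique`, ★ `algHom_ext_of_comp_map`);
* `sub_mem_of_comp_map_of_forall` — two `A'`-algebra maps out of `A' ⊗_k B_S` agreeing modulo an ideal `I` on the image of
  `A' ⊗_k B` agree modulo `I` everywhere (the mod-`J` intertwining of lifted data survives restriction);
* **`sub_mem_of_comp_map₂`** — `F_S` again reduces to `1 ⊗ g_S` modulo `𝔫'`, for ANY `k`-algebra map `g_S : B_S → C_T` compatible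
  with `g` (`g_S ∘ loc_B = loc_C ∘ g`): `F_S y − (1 ⊗ g_S) y ∈ 𝔫'(A' ⊗_k C_T)` for all `y`.

Cell `hodgecm-mathlib` (D-0151), F-11 α1 / J4-(iv) brick (iv-1b) (Čech functoriality of the obstruction, B-p08 (g16); census Q3):
restrictions of the chart lifts `F_j` to the pair and triple overlaps.  Count-neutral generic capital.  HC_CM is proved only modulo
the 7 printed citations until rung 0 closes — nothing here bears on a summit statement.

## References
* [Hartshorne2010] R. Hartshorne, *Deformation Theory*, GTM 257, Springer (2010): Thm. 10.2 (a) and its proof (p. 81),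
  Remark 10.1.1 (p. 80).
-/

noncomputable section

open TensorProduct

namespace Literature.AlgebraicGeometry.Deformation.SmoothAffineDeformation

variable {k : Type*} [CommRing k]
variable {A' : Type*} [CommRing A'] [Algebra k A']
variable {B : Type*} [CommRing B] [Algebra k B] {C : Type*} [CommRing C] [Algebra k C]
variable (𝔫' : Ideal A')
variable {Bs : Type*} [CommRing Bs] [Algebra k Bs] [Algebra B Bs] [IsScalarTower k B Bs]
variable {Ct : Type*} [CommRing Ct] [Algebra k Ct] [Algebra C Ct] [IsScalarTower k C Ct]
variable (S : Submonoid B) [IsLocalization S Bs]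

include S

/-- **`(1 ⊗ loc_C)(F(1 ⊗ s))` is a unit** when `loc_C(g s)` is: it is `1 ⊗ loc_C(g s)` plus a nilpotent (`F ≡ 1 ⊗ g` modulo the
nilpotent `𝔫'`). [cite: Hartshorne2010, Thm. 10.2 (proof), p. 81] -/
theorem isUnit_map_apply_of_sub_mem₂ (h𝔫 : IsNilpotent 𝔫') (F : A' ⊗[k] B →ₐ[A'] A' ⊗[k] C) (g : B →ₐ[k] C)
    (hF : ∀ b : B, F ((1 : A') ⊗ₜ b) - (1 : A') ⊗ₜ g b ∈ 𝔫' • (⊤ : Submodule A' (A' ⊗[k] C)))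
    (hS : ∀ s : S, IsUnit (algebraMap C Ct (g (s : B)))) (s : S) :
    IsUnit (Algebra.TensorProduct.map (AlgHom.id A' A') (IsScalarTower.toAlgHom k C Ct) (F ((1 : A') ⊗ₜ (s : B)))) := by
  have hsplit : F ((1 : A') ⊗ₜ (s : B)) = (1 : A') ⊗ₜ g (s : B) + (F ((1 : A') ⊗ₜ (s : B)) - (1 : A') ⊗ₜ g (s : B)) := by
    abel
  rw [hsplit, map_add, Algebra.TensorProduct.map_tmul, AlgHom.id_apply, IsScalarTower.coe_toAlgHom',
    ← Algebra.TensorProduct.includeRight_apply]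
  exact (isNilpotent_of_mem_smul_top 𝔫' h𝔫 (map_mem_smul_top_of_mem (Bs := Ct) 𝔫' (hF _))).isUnit_add_left_of_commute
    ((hS s).map _) (Commute.all _ _)

/-- **Restriction of a chart lift to the localized charts**: an `A'`-algebra map `F_S : A' ⊗_k B_S → A' ⊗_k C_T` with
`F_S ∘ (1 ⊗ loc_B) = (1 ⊗ loc_C) ∘ F`. [cite: Hartshorne2010, Thm. 10.2 (proof), p. 81] -/
theorem exists_algHom_localization₂ (h𝔫 : IsNilpotent 𝔫') (F : A' ⊗[k] B →ₐ[A'] A' ⊗[k] C) (g : B →ₐ[k] C)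
    (hF : ∀ b : B, F ((1 : A') ⊗ₜ b) - (1 : A') ⊗ₜ g b ∈ 𝔫' • (⊤ : Submodule A' (A' ⊗[k] C)))
    (hS : ∀ s : S, IsUnit (algebraMap C Ct (g (s : B)))) :
    ∃ Fs : A' ⊗[k] Bs →ₐ[A'] A' ⊗[k] Ct, ∀ x,
      Fs (Algebra.TensorProduct.map (AlgHom.id A' A') (IsScalarTower.toAlgHom k B Bs) x) =
        Algebra.TensorProduct.map (AlgHom.id A' A') (IsScalarTower.toAlgHom k C Ct) (F x) := by
  -- `φ₀ : B → A' ⊗ C_T`, `b ↦ (1 ⊗ loc_C)(F(1 ⊗ b))`, inverts `S`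
  let φ₀ : B →ₐ[k] A' ⊗[k] Ct :=
    ((Algebra.TensorProduct.map (AlgHom.id A' A') (IsScalarTower.toAlgHom k C Ct)).restrictScalars k).comp
      (((F : A' ⊗[k] B →ₐ[A'] A' ⊗[k] C).restrictScalars k).comp Algebra.TensorProduct.includeRight)
  have hφ₀ : ∀ b, φ₀ b = Algebra.TensorProduct.map (AlgHom.id A' A') (IsScalarTower.toAlgHom k C Ct)
      (F ((1 : A') ⊗ₜ b)) := fun b => rfl
  have hunit : ∀ s : S, IsUnit (φ₀ s) := fun s => by
    rw [hφ₀]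
    exact isUnit_map_apply_of_sub_mem₂ (Ct := Ct) 𝔫' S h𝔫 F g hF hS s
  let φ : Bs →ₐ[k] A' ⊗[k] Ct := IsLocalization.liftAlgHom (M := S) hunit
  have hφ : ∀ b : B, φ (algebraMap B Bs b) = φ₀ b := fun b => by
    simp only [φ, IsLocalization.liftAlgHom_apply]
    exact IsLocalization.lift_eq _ b
  refine ⟨Algebra.TensorProduct.lift (Algebra.TensorProduct.includeLeft (S := A')) φ (fun _ _ => Commute.all _ _),
    fun x => ?_⟩
  induction x using TensorProduct.induction_on with
  | zero => simp
  | tmul a b =>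
    rw [Algebra.TensorProduct.map_tmul, AlgHom.id_apply, IsScalarTower.coe_toAlgHom', Algebra.TensorProduct.lift_tmul,
      hφ, hφ₀, Algebra.TensorProduct.includeLeft_apply]
    have hab : (a ⊗ₜ[k] b : A' ⊗[k] B) = a • ((1 : A') ⊗ₜ[k] b) := by
      rw [TensorProduct.smul_tmul', smul_eq_mul, mul_one]
    rw [hab, map_smul, map_smul, Algebra.smul_def, Algebra.TensorProduct.algebraMap_apply, Algebra.algebraMap_self,
      RingHom.id_apply]
  | add x y hx hy => simp only [map_add, hx, hy]

/-- The restriction is unique: two `A'`-algebra maps `A' ⊗_k B_S → A' ⊗_k C_T` extending `F` coincide (maps out of a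
localization are determined on the base ring, ★ `algHom_ext_of_comp_map`). [cite: Hartshorne2010, Thm. 10.2 (proof), p. 81] -/
theorem algHom_localization₂_unique (F : A' ⊗[k] B →ₐ[A'] A' ⊗[k] C) {Fs₁ Fs₂ : A' ⊗[k] Bs →ₐ[A'] A' ⊗[k] Ct}
    (h₁ : ∀ x, Fs₁ (Algebra.TensorProduct.map (AlgHom.id A' A') (IsScalarTower.toAlgHom k B Bs) x) =
      Algebra.TensorProduct.map (AlgHom.id A' A') (IsScalarTower.toAlgHom k C Ct) (F x))
    (h₂ : ∀ x, Fs₂ (Algebra.TensorProduct.map (AlgHom.id A' A') (IsScalarTower.toAlgHom k B Bs) x) =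
      Algebra.TensorProduct.map (AlgHom.id A' A') (IsScalarTower.toAlgHom k C Ct) (F x)) : Fs₁ = Fs₂ := by
  refine algHom_ext_of_comp_map S fun b => ?_
  have e : ((1 : A') ⊗ₜ[k] algebraMap B Bs b : A' ⊗[k] Bs) =
      Algebra.TensorProduct.map (AlgHom.id A' A') (IsScalarTower.toAlgHom k B Bs) ((1 : A') ⊗ₜ b) := by
    rw [Algebra.TensorProduct.map_tmul, AlgHom.id_apply, IsScalarTower.coe_toAlgHom']
  rw [e, h₁, h₂]

/-- **Two `A'`-algebra maps out of `A' ⊗_k B_S` which agree modulo an ideal `I ⊆ A'` on `(1 ⊗ loc_B)(A' ⊗_k B)` agree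
modulo `I` everywhere** (`a ⊗ b/s = (a ⊗ b)(1 ⊗ 1/s)`, and `P(v) − Q(v)` for the inverse `v = 1 ⊗ 1/s` of the unit `u = 1 ⊗ s` is
`P(v)Q(v)(Q(u) − P(u))`).  Used twice: `Q = 1 ⊗ g_S` (the restriction of a chart lift again reduces to `1 ⊗ g`), and
`P = F_l ∘ ρ^X`, `Q = ρ^Y ∘ F_j` (the mod-`J` intertwining of lifted gluing data survives restriction to a smaller overlap).
[cite: Hartshorne2010, Thm. 10.2 (proof), p. 81] -/
theorem sub_mem_of_comp_map_of_forall (I : Ideal A') {D : Type*} [CommRing D] [Algebra A' D]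
    (P Q : A' ⊗[k] Bs →ₐ[A'] D)
    (h : ∀ x : A' ⊗[k] B, P (Algebra.TensorProduct.map (AlgHom.id A' A') (IsScalarTower.toAlgHom k B Bs) x) -
      Q (Algebra.TensorProduct.map (AlgHom.id A' A') (IsScalarTower.toAlgHom k B Bs) x) ∈ I • (⊤ : Submodule A' D))
    (y : A' ⊗[k] Bs) : P y - Q y ∈ I • (⊤ : Submodule A' D) := by
  rw [Ideal.smul_top_eq_map, Submodule.restrictScalars_mem]
  set I' : Ideal D := I.map (algebraMap A' D) with hI'
  have hmap : ∀ x : A' ⊗[k] B, P (Algebra.TensorProduct.map (AlgHom.id A' A') (IsScalarTower.toAlgHom k B Bs) x) -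
      Q (Algebra.TensorProduct.map (AlgHom.id A' A') (IsScalarTower.toAlgHom k B Bs) x) ∈ I' := fun x => by
    have := h x
    rwa [Ideal.smul_top_eq_map, Submodule.restrictScalars_mem] at this
  have hmul : ∀ y z : A' ⊗[k] Bs, P y - Q y ∈ I' → P z - Q z ∈ I' → P (y * z) - Q (y * z) ∈ I' := by
    intro y z hy hz
    have e : P (y * z) - Q (y * z) = (P y - Q y) * P z + Q y * (P z - Q z) := by rw [map_mul, map_mul]; ring
    rw [e]
    exact I'.add_mem (I'.mul_mem_right _ hy) (I'.mul_mem_left _ hz)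
  have hinv : ∀ s : S, P ((1 : A') ⊗ₜ IsLocalization.mk' Bs (1 : B) s) - Q ((1 : A') ⊗ₜ IsLocalization.mk' Bs (1 : B) s) ∈ I' := by
    intro s
    set u : A' ⊗[k] Bs := (1 : A') ⊗ₜ[k] algebraMap B Bs (s : B) with hu
    set v : A' ⊗[k] Bs := (1 : A') ⊗ₜ IsLocalization.mk' Bs (1 : B) s with hv
    have huv : u * v = 1 := by
      rw [hu, hv, Algebra.TensorProduct.tmul_mul_tmul, one_mul, IsLocalization.mk'_spec', map_one]
      rfl
    have hPuv : P u * P v = 1 := by rw [← map_mul, huv, map_one]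
    have hQuv : Q u * Q v = 1 := by rw [← map_mul, huv, map_one]
    have hu' : P u - Q u ∈ I' := by
      have := hmap ((1 : A') ⊗ₜ (s : B))
      rwa [Algebra.TensorProduct.map_tmul, AlgHom.id_apply, IsScalarTower.coe_toAlgHom'] at this
    have key : P v - Q v = (P v * Q v) * (Q u - P u) := by
      calc P v - Q v = P v * (Q u * Q v) - Q v * (P u * P v) := by rw [hQuv, hPuv, mul_one, mul_one]
        _ = _ := by ring
    rw [key]
    refine I'.mul_mem_left _ ?_
    rw [← neg_sub]
    exact I'.neg_mem hu'
  induction y using TensorProduct.induction_on with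
  | zero => rw [map_zero, map_zero, sub_zero]; exact I'.zero_mem
  | tmul a z =>
    obtain ⟨⟨b, s⟩, hz⟩ := IsLocalization.mk'_surjective S z
    simp only at hz
    subst hz
    have hsplit : (a ⊗ₜ[k] IsLocalization.mk' Bs b s : A' ⊗[k] Bs) =
        (a ⊗ₜ[k] algebraMap B Bs b) * ((1 : A') ⊗ₜ IsLocalization.mk' Bs (1 : B) s) := by
      rw [Algebra.TensorProduct.tmul_mul_tmul, mul_one, ← IsLocalization.mk'_eq_mul_mk'_one]
    rw [hsplit]
    refine hmul _ _ ?_ (hinv s)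
    have := hmap (a ⊗ₜ b)
    rwa [Algebra.TensorProduct.map_tmul, AlgHom.id_apply, IsScalarTower.coe_toAlgHom'] at this
  | add y z hy hz =>
    have e : P (y + z) - Q (y + z) = (P y - Q y) + (P z - Q z) := by rw [map_add, map_add]; ring
    rw [e]
    exact I'.add_mem hy hz

/-- **The restriction again reduces to `1 ⊗ g_S` modulo `𝔫'`**, for any `k`-algebra map `g_S : B_S → C_T` compatible with `g`
(`g_S(loc_B b) = loc_C(g b)`): `F_S y − (1 ⊗ g_S) y ∈ 𝔫'(A' ⊗_k C_T)` for ALL `y`.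
[cite: Hartshorne2010, Thm. 10.2 (proof), p. 81] -/
theorem sub_mem_of_comp_map₂ (F : A' ⊗[k] B →ₐ[A'] A' ⊗[k] C) (g : B →ₐ[k] C)
    (hF : ∀ b : B, F ((1 : A') ⊗ₜ b) - (1 : A') ⊗ₜ g b ∈ 𝔫' • (⊤ : Submodule A' (A' ⊗[k] C)))
    (gs : Bs →ₐ[k] Ct) (hgs : ∀ b : B, gs (algebraMap B Bs b) = algebraMap C Ct (g b))
    (Fs : A' ⊗[k] Bs →ₐ[A'] A' ⊗[k] Ct)
    (hFs : ∀ x, Fs (Algebra.TensorProduct.map (AlgHom.id A' A') (IsScalarTower.toAlgHom k B Bs) x) =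
      Algebra.TensorProduct.map (AlgHom.id A' A') (IsScalarTower.toAlgHom k C Ct) (F x)) (y : A' ⊗[k] Bs) :
    Fs y - Algebra.TensorProduct.map (AlgHom.id A' A') gs y ∈ 𝔫' • (⊤ : Submodule A' (A' ⊗[k] Ct)) := by
  refine sub_mem_of_comp_map_of_forall S 𝔫' Fs (Algebra.TensorProduct.map (AlgHom.id A' A') gs) (fun x => ?_) y
  -- `F` reduces to `1 ⊗ g` modulo `𝔫'` everywhere
  have hF' : ∀ x : A' ⊗[k] B, F x - Algebra.TensorProduct.map (AlgHom.id A' A') g x ∈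
      𝔫' • (⊤ : Submodule A' (A' ⊗[k] C)) := fun x => by
    induction x using TensorProduct.induction_on with
    | zero => simp
    | tmul a b =>
      have hab : (a ⊗ₜ[k] b : A' ⊗[k] B) = a • ((1 : A') ⊗ₜ[k] b) := by
        rw [TensorProduct.smul_tmul', smul_eq_mul, mul_one]
      have hab' : (Algebra.TensorProduct.map (AlgHom.id A' A') g (a ⊗ₜ[k] b) : A' ⊗[k] C) = a • ((1 : A') ⊗ₜ[k] g b) := by
        rw [Algebra.TensorProduct.map_tmul, AlgHom.id_apply, TensorProduct.smul_tmul', smul_eq_mul, mul_one]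
      rw [hab', hab, map_smul, ← smul_sub]
      exact Submodule.smul_mem _ a (hF b)
    | add x y hx hy =>
      have e : F (x + y) - Algebra.TensorProduct.map (AlgHom.id A' A') g (x + y) =
          (F x - Algebra.TensorProduct.map (AlgHom.id A' A') g x) + (F y - Algebra.TensorProduct.map (AlgHom.id A' A') g y) := by
        simp only [map_add]; abel
      rw [e]
      exact Submodule.add_mem _ hx hy
  -- `(1 ⊗ g_S) ∘ (1 ⊗ loc_B) = (1 ⊗ loc_C) ∘ (1 ⊗ g)`
  have hGloc : Algebra.TensorProduct.map (AlgHom.id A' A') gs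
        (Algebra.TensorProduct.map (AlgHom.id A' A') (IsScalarTower.toAlgHom k B Bs) x) =
      Algebra.TensorProduct.map (AlgHom.id A' A') (IsScalarTower.toAlgHom k C Ct)
        (Algebra.TensorProduct.map (AlgHom.id A' A') g x) := by
    induction x using TensorProduct.induction_on with
    | zero => simp
    | tmul a b =>
      rw [Algebra.TensorProduct.map_tmul, Algebra.TensorProduct.map_tmul, Algebra.TensorProduct.map_tmul,
        Algebra.TensorProduct.map_tmul, AlgHom.id_apply, AlgHom.id_apply, IsScalarTower.coe_toAlgHom',
        IsScalarTower.coe_toAlgHom', hgs]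
    | add x y hx hy => simp only [map_add, hx, hy]
  rw [hFs, hGloc, ← map_sub]
  exact map_mem_smul_top_of_mem (Bs := Ct) 𝔫' (hF' x)

end Literature.AlgebraicGeometry.Deformation.SmoothAffineDeformation

end
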